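import Mathlib
import Literature.Computability.AutomaticStructures.AutomaticBlock

/-!
# Kummer's carry identity in `ℤ/ℓ^N`: digit-sum conservation forbids carries

Route `MatrixMultiplication/AutomaticSTPPDesigns`, crux `stmt-MatrixMultiplication-7357`
(`AutomaticDesignBelowFourFifths`), line `digit-sum-sliced-laser`; registered stub `stub_digitwise`.

For base-`ℓ` digit vectors `x y z : Fin N → Fin ℓ` (`ℓ ≥ 2`, least significant digit first) with
`[x]_ℓ + [y]_ℓ = [z]_ℓ` in `ℤ/ℓ^N` AND equal digit sums `∑ x_t + ∑ y_t = ∑ z_t`, the addition is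
carry-free and wrap-free: `x_t + y_t = z_t` for every `t` (Kummer 1852 / Legendre: every carry costs
`ℓ - 1` units of digit sum, a wrap past `ℓ^N` costs at least one more).

Proof (over the tree's carry recursion `intCast_sum_mul_pow_eq_zero_iff`, AutomaticBlock.lean): with
`d_t = x_t + y_t - z_t ∈ [-(ℓ-1), 2(ℓ-1)]` the value relation gives carries `c` with `c 0 = 0`,
`c_t + d_t = ℓ c_{t+1}`; inductively every carry is `≥ 0` (`ℓ c_{t+1} ≥ -(ℓ-1) > -ℓ`); summing the
recursion and telescoping, `0 = ∑ d_t = (ℓ - 1) ∑_t c_{t+1} + c_N`, a sum of non-negative terms, so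
all carries vanish and `d_t = 0`.
-/

-- single-conjunct summit: the mandated namespace repeats `MatrixMultiplication`.
set_option linter.dupNamespace false

namespace Summit.MatrixMultiplication.MatrixMultiplication.Theorems

namespace AutomaticDesignBelowFourFifths

open Finset
open scoped BigOperators
open Literature.Computability.AutomaticStructures

/-- Bridge to the carry lemma: in `ZMod (ℓ^N)`, `[x]_ℓ + [y]_ℓ - [z]_ℓ` is the cast of
`∑_j d_j ℓ^j` with `d_j = x_j + y_j - z_j` (cf. the tree's `stppSum_eq_intCast`). [folklore] -/
theorem digitwise_sum_eq_intCast {ℓ N : ℕ} (x y z : Fin N → Fin ℓ) :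
    (digitValue x : ZMod (ℓ ^ N)) + digitValue y - digitValue z =
      ((∑ j : Fin N, (((x j : ℤ) + y j - z j) * (ℓ : ℤ) ^ (j : ℕ)) : ℤ) : ZMod (ℓ ^ N)) := by
  simp only [digitValue]
  push_cast
  simp only [Finset.sum_add_distrib, Finset.sum_sub_distrib, add_mul, sub_mul]

/-- Carries of the recursion `c 0 = 0`, `c_t + d_t = ℓ c_{t+1}` with digits bounded below by
`-(ℓ - 1)` are non-negative (`ℓ c_{t+1} ≥ 0 - (ℓ - 1) > -ℓ`). [folklore] -/
theorem digitwise_carry_nonneg {ℓ N : ℕ} {c : Fin (N + 1) → ℤ} {d : Fin N → ℤ}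
    (h0 : c 0 = 0) (hrel : ∀ j : Fin N, c j.castSucc + d j = ℓ * c j.succ)
    (hd : ∀ j : Fin N, -((ℓ : ℤ) - 1) ≤ d j) : ∀ i : Fin (N + 1), 0 ≤ c i := by
  intro i
  induction i using Fin.induction with
  | zero => simp [h0]
  | succ i ih =>
    have h1 : -(ℓ : ℤ) < ℓ * c i.succ := by
      rw [← hrel i]
      have := hd i
      omega
    by_contra hlt
    push Not at hlt
    have h2 : c i.succ ≤ -1 := by omega
    have h3 : (ℓ : ℤ) * c i.succ ≤ ℓ * (-1) :=
      mul_le_mul_of_nonneg_left h2 (by positivity)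
    omega

/-- The carry recursion `c 0 = 0`, `c_t + d_t = ℓ c_{t+1}` (`ℓ ≥ 2`) with digits `d_t ≥ -(ℓ - 1)`
and `∑ d_t = 0` has only the zero solution: summing and telescoping,
`0 = ∑ d_t = (ℓ - 1) ∑_t c_{t+1} + c_N` with all terms `≥ 0`. [folklore] -/
theorem digitwise_carry_eq_zero {ℓ N : ℕ} (hℓ : 2 ≤ ℓ) {c : Fin (N + 1) → ℤ} {d : Fin N → ℤ}
    (h0 : c 0 = 0) (hrel : ∀ j : Fin N, c j.castSucc + d j = ℓ * c j.succ)
    (hd : ∀ j : Fin N, -((ℓ : ℤ) - 1) ≤ d j) (hsum : ∑ j : Fin N, d j = 0) :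
    ∀ i : Fin (N + 1), c i = 0 := by
  have hnn := digitwise_carry_nonneg h0 hrel hd
  -- sum the recursion over `t : Fin N`
  have hrec : ∑ j : Fin N, (c j.castSucc + d j) = ∑ j : Fin N, (ℓ : ℤ) * c j.succ :=
    Finset.sum_congr rfl fun j _ => hrel j
  rw [Finset.sum_add_distrib, hsum, add_zero, ← Finset.mul_sum] at hrec
  -- telescope: both `Fin.sum_univ_castSucc` and `Fin.sum_univ_succ` compute `∑_{Fin (N+1)} c`
  have htel : (∑ j : Fin N, c j.castSucc) + c (Fin.last N) = c 0 + ∑ j : Fin N, c j.succ := by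
    rw [← Fin.sum_univ_castSucc, ← Fin.sum_univ_succ]
  have hSnn : 0 ≤ ∑ j : Fin N, c j.succ := Finset.sum_nonneg fun j _ => hnn _
  have hlast := hnn (Fin.last N)
  have hℓZ : (2 : ℤ) ≤ ℓ := by exact_mod_cast hℓ
  have hS : ∑ j : Fin N, c j.succ = 0 := by nlinarith
  have hsucc : ∀ j : Fin N, c j.succ = 0 := fun j =>
    (Finset.sum_eq_zero_iff_of_nonneg fun j _ => hnn (Fin.succ j)).1 hS j (Finset.mem_univ _)
  intro i
  exact Fin.cases h0 hsucc i

/-! ### Registered sub-goal (stub) of crux `stmt-MatrixMultiplication-7357`, closed form -/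

/-- **Registered stub `stub_digitwise` — digitwise from digit-sum conservation** (Kummer 1852 /
Legendre: `s(x) + s(y) = s(x+y) + (ℓ-1)·#carries`, and a wrap past `ℓ^N` costs at least one more
unit): if `[x]_ℓ + [y]_ℓ = [z]_ℓ` in `ℤ/ℓ^N` for digit vectors `x y z : Fin N → Fin ℓ` (`ℓ ≥ 2`) and
`∑ x_t + ∑ y_t = ∑ z_t`, then `x_t + y_t = z_t` for every `t`. [folklore] -/
theorem stub_digitwise :
    ∀ (ℓ N : ℕ), 2 ≤ ℓ → ∀ x y z : Fin N → Fin ℓ,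
      (digitValue x : ZMod (ℓ ^ N)) + (digitValue y : ZMod (ℓ ^ N)) =
          (digitValue z : ZMod (ℓ ^ N)) →
      (∑ t, (x t : ℕ)) + (∑ t, (y t : ℕ)) = ∑ t, (z t : ℕ) →
      ∀ t, (x t : ℕ) + y t = z t := by
  intro ℓ N hℓ x y z hval hsum t
  have hp : 0 < ℓ := by omega
  -- the digit differences
  set d : Fin N → ℤ := fun j => (x j : ℤ) + y j - z j with hd_def
  -- the value relation in carry form
  have hzero : ((0 + ∑ j : Fin N, d j * (ℓ : ℤ) ^ (j : ℕ) : ℤ) : ZMod (ℓ ^ N)) = 0 := by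
    rw [zero_add, ← digitwise_sum_eq_intCast x y z, hval, sub_self]
  obtain ⟨c, hc0, hc⟩ := (intCast_sum_mul_pow_eq_zero_iff hp N 0 d).1 hzero
  -- digit bounds and digit-sum conservation over `ℤ`
  have hdlo : ∀ j : Fin N, -((ℓ : ℤ) - 1) ≤ d j := fun j => by
    have hz := (z j).isLt
    simp only [hd_def]
    omega
  have hdsum : ∑ j : Fin N, d j = 0 := by
    have h := congrArg (Nat.cast : ℕ → ℤ) hsum
    push_cast at h
    simp only [hd_def, Finset.sum_sub_distrib, Finset.sum_add_distrib]
    linarith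
  -- all carries vanish, hence `d t = 0`
  have hall := digitwise_carry_eq_zero hℓ hc0 hc hdlo hdsum
  have hdt : d t = 0 := by
    have h := hc t
    rw [hall, hall, mul_zero, zero_add] at h
    exact h
  simp only [hd_def] at hdt
  omega

end AutomaticDesignBelowFourFifths

end Summit.MatrixMultiplication.MatrixMultiplication.Theorems
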